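import Summits.BirchSwinnertonDyer.BirchSwinnertonDyer.Theorems.PrintX8SharpFlatMuTransfer
import Summits.BirchSwinnertonDyer.BirchSwinnertonDyer.Theses.PrintX8
import HarnessLib

/-!
# Route `PrintX8`, crux `SharpFlatMainConjectureSmallImageX8` (stmt-BirchSwinnertonDyer-20402) BY NAME from
# K1 (stmt-19875) + the analytic rider of the ♯/♭ μ-transfer — the route-decl GLUE of
# `Theorems/PrintX8SharpFlatMuTransfer.lean` (cell `bsd-print-x8`, seat p1 gen 2; `--supports` 20402;
# theorems only; this file imports the route file, the μ-transfer file does not)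

PARTITION (cell bsd-print-x8, leaf `ClassX8`): types-the-object-of; closes NONE (conditional on K1, the
rider, the construction fact `Sprung2012.thm714seq_sharpFlatColemanKato_zeta` and three published
facts); 0 cells move; beyond-print theorem: no. HONEST FRAMING as in the μ-transfer file: crux 20402
stays OPEN (its Eisenstein half K1 has no engine in print; the rider is the Perrin-Riou / Pollack
`μ(L^{♯/♭}) = 0` expectation class-wide, a finite certificate per pair).

References: [Sprung2012] Def. 6.1, Thm. 7.14, Thm. 7.16, Main [C] 7.21; [Kato2004Asterisque] Thm. 12.6,
§13.8; tree: `Theorems/PrintX8SharpFlatMuTransfer.lean` (§2), p3 g1's `PrintX8SmallImageMuReading` /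
`PrintX8SmallImageMuSplit`.
-/

set_option linter.dupNamespace false
set_option autoImplicit false

noncomputable section

open scoped Classical NumberField MatrixGroups ModularForm

open NumberField IsDedekindDomain WeierstrassCurve CongruenceSubgroup Field
  Literature.NumberTheory.EllipticCurves Literature.NumberTheory.EllipticCurves.ModularForms
  Literature.NumberTheory.EllipticCurves.Rank1Residual
  Literature.NumberTheory.EllipticCurves.Sprung2017 Literature.NumberTheory.EllipticCurves.Sprung2012
  Literature.NumberTheory.EllipticCurves.GreenbergVatsal2000
  Literature.NumberTheory.EllipticCurves.ZpExtension Literature.NumberTheory.EllipticCurves.IwasawaAlgebra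
  Summit.BirchSwinnertonDyer.BirchSwinnertonDyer.Theorems

namespace Summit.BirchSwinnertonDyer.BirchSwinnertonDyer.Theorems.PrintX8SharpFlatMuTransfer

/-- **20402 ⟸ 19875 + the analytic rider, modulo `hCK` and three published facts.** The crux
`SharpFlatMainConjectureSmallImageX8` (♯/♭ main [C] on the X8 pairs with `ρ̄_{E,3}` not onto and analytic
rank `≤ 1`, both colours) follows from K1 `SprungLowerDivisibilityAtThree` BY NAME and the displayed
class-wide rider «on those pairs, for every colour, the `•`-member of the Sprung pair of every newform has
a unit coefficient when non-zero» (the Perrin-Riou / Pollack `μ = 0` expectation; per pair a finite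
certificate), granted `hCK`, Sprung 2012 Thm. 7.14 / Thm. 7.16 (rational) and the period unit at `3`.
§2 ∘ p3 g1's `PrintX8MuSplit.sharpFlatMainConjectureSmallImageX8_of_sprungLowerDivisibilityAtThree_of_muInvariant_eq_zero`.
CONDITIONAL; closes nothing; the rank hypothesis is unused (the road is rank-free).
[cite: Sprung2012, Thm. 7.14, Thm. 7.16 (p. 1504) and Main Conj. 7.21 (p. 1505)] [cite: Kato2004Asterisque, Thm. 12.6 (p. 222), §13.8] -/
theorem sharpFlatMainConjectureSmallImageX8_of_K1_of_sharpFlatMuAn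
    (hCK : thm714seq_sharpFlatColemanKato_zeta)
    (h714 : thm714_sharpFlatSelmerDual_finite_torsion)
    (h716 : thm716_sharpFlatCharIdeal_divisibility)
    (h3 : realPeriodRat_eq_unit_mul_plusPeriod_three)
    (hK1 : Theses.PrintX8.SprungLowerDivisibilityAtThree)
    (hμan : ∀ (W : WeierstrassCurve ℚ) [W.IsElliptic] [W.IsGloballyMinimal] (p : ℕ) [Fact p.Prime],
        ClassX8 W p → ¬ Surj W p → ∀ (col : Chroma)
        (N : ℕ) (_ : NeZero N) (f : CuspForm (Gamma0 N) 2) (Lsharp Lflat : IwasawaAlgebra p),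
        IsNewformOf W f → IsSprungPair f p (W.frobeniusTrace p) Lsharp Lflat →
        chromaticL col Lsharp Lflat ≠ 0 → HasUnitContent (chromaticL col Lsharp Lflat)) :
    Theses.PrintX8.SharpFlatMainConjectureSmallImageX8 := by
  intro W _ _ p _ hX hns _ col
  exact X8.sprungSharpFlatMainConjecture_of_lowerDivisibility_of_sharpFlatMuAn W p hCK h714 h716 h3 hX
    hns col (hK1 W p hX col) (hμan W p hX hns col)

/-- **The same from the route's `PublishedInputsX8` BY NAME** (conjuncts 4, 5, 7: Sprung 2012 Thm. 7.14,
Thm. 7.16, the period unit at `3`), plus `hCK` and the rider. CONDITIONAL; closes nothing.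
[cite: Sprung2012, Thm. 7.14, Thm. 7.16 (p. 1504) and Main Conj. 7.21 (p. 1505)] -/
theorem sharpFlatMainConjectureSmallImageX8_of_publishedInputs_of_K1_of_sharpFlatMuAn
    (hCK : thm714seq_sharpFlatColemanKato_zeta) (hPub : Theses.PrintX8.PublishedInputsX8)
    (hK1 : Theses.PrintX8.SprungLowerDivisibilityAtThree)
    (hμan : ∀ (W : WeierstrassCurve ℚ) [W.IsElliptic] [W.IsGloballyMinimal] (p : ℕ) [Fact p.Prime],
        ClassX8 W p → ¬ Surj W p → ∀ (col : Chroma)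
        (N : ℕ) (_ : NeZero N) (f : CuspForm (Gamma0 N) 2) (Lsharp Lflat : IwasawaAlgebra p),
        IsNewformOf W f → IsSprungPair f p (W.frobeniusTrace p) Lsharp Lflat →
        chromaticL col Lsharp Lflat ≠ 0 → HasUnitContent (chromaticL col Lsharp Lflat)) :
    Theses.PrintX8.SharpFlatMainConjectureSmallImageX8 := by
  obtain ⟨-, -, -, h714, h716, -, h3, -⟩ := hPub
  exact sharpFlatMainConjectureSmallImageX8_of_K1_of_sharpFlatMuAn hCK h714 h716 h3 hK1 hμan


end Summit.BirchSwinnertonDyer.BirchSwinnertonDyer.Theorems.PrintX8SharpFlatMuTransfer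

end
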